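/-
Copyright: the b2b-balaban T⁴-continuum CRUX team, row NE7b OWNER lineage `t4-ne7b-p1` (gen 105). Project licence.
-/
import Summits.QuantumFields.BalabanUV.T4Continuum.Spine.NE7b.GaussianRestrictedMoment
import Mathlib.MeasureTheory.Group.Integral

/-!
# THE SHIFTED NEAR-BLOCK MOMENT: completing the square turns the exterior coupling into a TRANSLATION, and the price of the shift is
# the INDUCED-MEAN ENERGY `mᵀQm` on the pinned region — residual (R1′) reduced to (R1″) (row NE7b, node U5c; kernel theorems)

Cell `pub-balaban`, sub-cell `t4`, spine estimate NE7b (`T4WeightBudget.RelWeightBound`; the cell's OWN estimate — NOT PRINTED in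
[Bałaban 1983–89], NOT PROVED).  Crux-route work under `Spine/NE7b/` by the row's OWNER; NOTHING of Bałaban's is named or asserted;
no `T4Continuum/Support` leaf typed; zero `sorry`.

WHY.  `…NE7b.GaussianFibrewiseDecoupling.restrictedMoment_le_of_shifted_fibres` reduced the decoupling residual (R1) to (R1′): a bound,
uniform over the far small-field configurations `x₂`, on the near-block restricted moment of the Gaussian `e^{−(x₁ᵀSx₁ + 2x₁ᵀv)}` SHIFTED
by the exterior coupling `v = S₁₂x₂`.  THIS FILE prices the shift.  Completing the square, `x₁ᵀSx₁ + 2x₁ᵀv = (x₁+m)ᵀS(x₁+m) − mᵀSm` with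
the INDUCED MEAN `m = S⁻¹v`; the constant `e^{mᵀSm}` CANCELS in the ratio and the translation `u = x₁ + m` (Lebesgue measure is translation
invariant) turns the shifted moment into the moment of the TRANSLATED sacrificed form `Q(u − m)` with the translated restriction `F(u − m)`
under the CENTRED Gaussian `e^{−uᵀSu}`.  Young's inequality for the positive-semidefinite `Q`, `(u−m)ᵀQ(u−m) ≤ (1+ε)·uᵀQu + (1+ε⁻¹)·mᵀQm`,
then gives: **shifted restricted moment `≤ e^{(1+ε⁻¹)·mᵀQm} · (√(1−δ'))⁻¹ ^ r ∕ (1 − η)`** once the INFLATED form `(1+ε)Q` is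
`δ'`-dominated (`δ' < 1`) of rank `≤ r` and the TRANSLATED restriction's large-field mass is `≤ η·∫e^{−S}` (`η < 1`).  So (R1′) is reduced to
the DISPLAYED residual **(R1″)**: a bound `mᵀQm ≤ B₀` on the INDUCED-MEAN ENERGY ON THE PINNED REGION from far small fields (`m = S⁻¹S₁₂x₂`;
in print: the `M R_k`-cube margins and the decay of the small-field Green's function — [Balaban1989LargeFieldI] p. 177 (i), [Balaban1989
LargeFieldII] (1.80)) and `η < 1` for the translated near restriction (thresholds versus the induced mean — the maximum principle).  Neither is
proved here.

WHAT IS PROVED ([folklore]):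
* §1 `qf_complete_square` (`xᵀSx + 2·xᵀv = (x+m)ᵀS(x+m) − mᵀSm`, `m = S⁻¹v`, `S` symmetric with `IsUnit (det S)`), `qf_young`
  (`(u−m)ᵀQ(u−m) ≤ (1+ε)uᵀQu + (1+ε⁻¹)mᵀQm` for `Q` positive semidefinite, `ε > 0`).
* §2 `shifted_integral_eq_translated` (completing the square + translation invariance, numerator and denominator forms),
  **`shiftedMoment_le`** (the bound above), **`shiftedMoment_le_of_inducedMean_le`** (with the displayed induced-mean energy bound `B₀`).

NOT HERE (honest): the induced-mean energy bound and `η < 1` for Bałaban's kernels ((R1″), (A1c) reading); the non-Gaussian remainder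
(R2); anything of Bałaban's.  NE7b NOT PRINTED ∕ NOT PROVED; spine PROVED 0∕9; rung (B)+1 on a FINITE torus — NOT infinite volume, NOT the
mass gap, NOT Clay.
HONEST DEPENDENCY: continuum YM on T⁴ ⇐ BetaPertH ∧ nine spine estimates (0/9 proved); BetaPertH ⇐ (D1) ∧ (D4) ∧ CAP+tail.
-/

set_option autoImplicit false

open Matrix Finset MeasureTheory Real
open Summit.QuantumFields.BalabanUV.T4Continuum.NE7b.QuadFormSimDiag
open Summit.QuantumFields.BalabanUV.T4Continuum.NE7b.GaussianDominatedMoment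
open Summit.QuantumFields.BalabanUV.T4Continuum.NE7b.GaussianRestrictedMoment

namespace Summit.QuantumFields.BalabanUV.T4Continuum.NE7b.GaussianShiftedFibre

variable {n : Type*} [Fintype n] [DecidableEq n]

/-! ## §1 Completing the square; Young's inequality for a positive-semidefinite form -/

omit [DecidableEq n] in
/-- For a symmetric real matrix the bilinear form is symmetric: `xᵀSm = mᵀSx`. [folklore] -/
theorem dotProduct_mulVec_symm {S : Matrix n n ℝ} (hS : S.IsSymm) (x m : n → ℝ) : x ⬝ᵥ (S *ᵥ m) = m ⬝ᵥ (S *ᵥ x) := by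
  rw [dotProduct_mulVec, ← mulVec_transpose, hS.eq, dotProduct_comm]

/-- **COMPLETING THE SQUARE**: for `S` symmetric with invertible determinant and `m = S⁻¹ v`,
`xᵀSx + 2·xᵀv = (x + m)ᵀS(x + m) − mᵀSm`. [folklore] -/
theorem qf_complete_square {S : Matrix n n ℝ} (hS : S.IsSymm) (hdet : IsUnit S.det) (x v : n → ℝ) :
    x ⬝ᵥ (S *ᵥ x) + 2 * (x ⬝ᵥ v) =
      (x + S⁻¹ *ᵥ v) ⬝ᵥ (S *ᵥ (x + S⁻¹ *ᵥ v)) - (S⁻¹ *ᵥ v) ⬝ᵥ (S *ᵥ (S⁻¹ *ᵥ v)) := by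
  have hSm : S *ᵥ (S⁻¹ *ᵥ v) = v := by rw [mulVec_mulVec, mul_nonsing_inv _ hdet, one_mulVec]
  have h1 : (S⁻¹ *ᵥ v) ⬝ᵥ (S *ᵥ x) = x ⬝ᵥ v := by rw [← dotProduct_mulVec_symm hS x (S⁻¹ *ᵥ v), hSm]
  rw [mulVec_add, hSm, add_dotProduct, dotProduct_add, dotProduct_add, h1]
  ring

omit [DecidableEq n] in
/-- **YOUNG'S INEQUALITY FOR A POSITIVE-SEMIDEFINITE FORM**: `(u − m)ᵀQ(u − m) ≤ (1+ε)·uᵀQu + (1+ε⁻¹)·mᵀQm` for `ε > 0`. [folklore] -/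
theorem qf_young {Q : Matrix n n ℝ} (hQ : Q.PosSemidef) (u m : n → ℝ) {ε : ℝ} (hε : 0 < ε) :
    (u - m) ⬝ᵥ (Q *ᵥ (u - m)) ≤ (1 + ε) * (u ⬝ᵥ (Q *ᵥ u)) + (1 + ε⁻¹) * (m ⬝ᵥ (Q *ᵥ m)) := by
  have hsymm : Q.IsSymm := by
    have h := hQ.1
    rw [IsHermitian, conjTranspose_eq_transpose_of_trivial] at h
    exact h
  -- `0 ≤ (εu + m)ᵀQ(εu + m) = ε²·uᵀQu + 2ε·uᵀQm + mᵀQm`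
  have h0 := qf_nonneg_of_posSemidef hQ (ε • u + m)
  have e0 : (ε • u + m) ⬝ᵥ (Q *ᵥ (ε • u + m)) =
      ε ^ 2 * (u ⬝ᵥ (Q *ᵥ u)) + 2 * ε * (u ⬝ᵥ (Q *ᵥ m)) + m ⬝ᵥ (Q *ᵥ m) := by
    rw [mulVec_add, mulVec_smul, add_dotProduct, dotProduct_add, dotProduct_add, smul_dotProduct, smul_dotProduct,
      dotProduct_smul, dotProduct_smul, dotProduct_mulVec_symm hsymm m u]
    simp only [smul_eq_mul]
    ring
  have e1 : (u - m) ⬝ᵥ (Q *ᵥ (u - m)) = u ⬝ᵥ (Q *ᵥ u) - 2 * (u ⬝ᵥ (Q *ᵥ m)) + m ⬝ᵥ (Q *ᵥ m) := by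
    rw [mulVec_sub, sub_dotProduct, dotProduct_sub, dotProduct_sub, dotProduct_mulVec_symm hsymm m u]
    ring
  rw [e0] at h0
  rw [e1]
  -- from `h0`: `−2·uᵀQm ≤ ε·uᵀQu + ε⁻¹·mᵀQm`
  have hQu := qf_nonneg_of_posSemidef hQ u
  have hQm := qf_nonneg_of_posSemidef hQ m
  have key : -(2 * (u ⬝ᵥ (Q *ᵥ m))) ≤ ε * (u ⬝ᵥ (Q *ᵥ u)) + ε⁻¹ * (m ⬝ᵥ (Q *ᵥ m)) := by
    have h' : 0 ≤ ε * (ε * (u ⬝ᵥ (Q *ᵥ u)) + ε⁻¹ * (m ⬝ᵥ (Q *ᵥ m)) + 2 * (u ⬝ᵥ (Q *ᵥ m))) := by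
      have : ε * (ε * (u ⬝ᵥ (Q *ᵥ u)) + ε⁻¹ * (m ⬝ᵥ (Q *ᵥ m)) + 2 * (u ⬝ᵥ (Q *ᵥ m))) =
          ε ^ 2 * (u ⬝ᵥ (Q *ᵥ u)) + 2 * ε * (u ⬝ᵥ (Q *ᵥ m)) + m ⬝ᵥ (Q *ᵥ m) := by
        field_simp
        ring
      rw [this]; exact h0
    have h'' := nonneg_of_mul_nonneg_right (by rwa [mul_comm] at h') hε
    linarith
  nlinarith

/-! ## §2 The shifted restricted moment -/

/-- **COMPLETING THE SQUARE + TRANSLATION INVARIANCE**: for any weight `G`,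
`∫ G(x)·e^{−(xᵀSx + 2xᵀv)} dx = e^{mᵀSm} · ∫ G(u − m)·e^{−uᵀSu} du` with `m = S⁻¹v`. [folklore] -/
theorem shifted_integral_eq_translated {S : Matrix n n ℝ} (hS : S.IsSymm) (hdet : IsUnit S.det) (v : n → ℝ)
    (G : (n → ℝ) → ℝ) :
    ∫ x, G x * exp (-(x ⬝ᵥ (S *ᵥ x) + 2 * (x ⬝ᵥ v))) =
      exp ((S⁻¹ *ᵥ v) ⬝ᵥ (S *ᵥ (S⁻¹ *ᵥ v))) * ∫ u, G (u - S⁻¹ *ᵥ v) * exp (-(u ⬝ᵥ (S *ᵥ u))) := by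
  set m : n → ℝ := S⁻¹ *ᵥ v with hm
  have e : ∀ x : n → ℝ, G x * exp (-(x ⬝ᵥ (S *ᵥ x) + 2 * (x ⬝ᵥ v))) =
      exp (m ⬝ᵥ (S *ᵥ m)) * (G ((x + m) - m) * exp (-((x + m) ⬝ᵥ (S *ᵥ (x + m))))) := fun x => by
    rw [qf_complete_square hS hdet x v, ← hm, add_sub_cancel_right, neg_sub, sub_eq_add_neg, exp_add]
    ring
  simp_rw [e, integral_const_mul]
  congr 1
  exact integral_add_right_eq_self (μ := (volume : Measure (n → ℝ)))
    (fun u => G (u - m) * exp (-(u ⬝ᵥ (S *ᵥ u)))) m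

/-- **THE SHIFTED RESTRICTED MOMENT IS PRICED BY THE INDUCED-MEAN ENERGY.**  Let `S` be positive definite, `Q` positive semidefinite
with the INFLATED form `(1+ε)·Q` `δ'`-dominated by `S` (`0 ≤ δ' < 1`, `ε > 0`) and `rank Q ≤ r`; let `0 ≤ F ≤ 1` be measurable and let
the TRANSLATED restriction `F(· − m)`, `m = S⁻¹v`, have large-field mass `≤ η·∫e^{−S}` (`η < 1`).  Then
`∫ F e^{xᵀQx} e^{−(xᵀSx + 2xᵀv)} ≤ [e^{(1+ε⁻¹)·mᵀQm} · (√(1−δ'))⁻¹ ^ r ∕ (1 − η)] · ∫ F e^{−(xᵀSx + 2xᵀv)}` — the exterior coupling `v`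
enters ONLY through the induced-mean energy `mᵀQm` on the support of `Q` (the pinned region). [folklore] -/
theorem shiftedMoment_le {S Q : Matrix n n ℝ} {δ' ε η : ℝ} {r : ℕ} (hS : S.PosDef) (hQ : Q.PosSemidef) (hε : 0 < ε)
    (hdom : (δ' • S - (1 + ε) • Q).PosSemidef) (hδ0 : 0 ≤ δ') (hδ : δ' < 1) (hr : Q.rank ≤ r) (v : n → ℝ)
    {F : (n → ℝ) → ℝ} (hF0 : ∀ x, 0 ≤ F x) (hF1 : ∀ x, F x ≤ 1) (hFm : Measurable F) (hη : η < 1)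
    (hmass : ∫ u, (1 - F (u - S⁻¹ *ᵥ v)) * exp (-(u ⬝ᵥ (S *ᵥ u))) ≤ η * ∫ u, exp (-(u ⬝ᵥ (S *ᵥ u)))) :
    ∫ x, F x * (exp (x ⬝ᵥ (Q *ᵥ x)) * exp (-(x ⬝ᵥ (S *ᵥ x) + 2 * (x ⬝ᵥ v)))) ≤
      (exp ((1 + ε⁻¹) * ((S⁻¹ *ᵥ v) ⬝ᵥ (Q *ᵥ (S⁻¹ *ᵥ v)))) * ((√(1 - δ'))⁻¹ ^ r / (1 - η))) *
        ∫ x, F x * exp (-(x ⬝ᵥ (S *ᵥ x) + 2 * (x ⬝ᵥ v))) := by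
  have hsymm : S.IsSymm := by
    have h := hS.1
    rw [IsHermitian, conjTranspose_eq_transpose_of_trivial] at h
    exact h
  have hdet : IsUnit S.det := isUnit_iff_ne_zero.2 hS.det_pos.ne'
  set m : n → ℝ := S⁻¹ *ᵥ v with hm
  -- numerator and denominator after completing the square
  have eN : ∫ x, F x * (exp (x ⬝ᵥ (Q *ᵥ x)) * exp (-(x ⬝ᵥ (S *ᵥ x) + 2 * (x ⬝ᵥ v)))) =
      exp (m ⬝ᵥ (S *ᵥ m)) * ∫ u, (F (u - m) * exp ((u - m) ⬝ᵥ (Q *ᵥ (u - m)))) * exp (-(u ⬝ᵥ (S *ᵥ u))) := by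
    have h := shifted_integral_eq_translated hsymm hdet v (fun x => F x * exp (x ⬝ᵥ (Q *ᵥ x)))
    simp only [mul_assoc] at h ⊢
    rw [h]
  have eD : ∫ x, F x * exp (-(x ⬝ᵥ (S *ᵥ x) + 2 * (x ⬝ᵥ v))) =
      exp (m ⬝ᵥ (S *ᵥ m)) * ∫ u, F (u - m) * exp (-(u ⬝ᵥ (S *ᵥ u))) :=
    shifted_integral_eq_translated hsymm hdet v F
  rw [eN, eD]
  -- the translated restriction is again in `[0,1]` and measurable
  have hG0 : ∀ u, 0 ≤ F (u - m) := fun u => hF0 _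
  have hG1 : ∀ u, F (u - m) ≤ 1 := fun u => hF1 _
  have hGm : AEStronglyMeasurable (fun u : n → ℝ => F (u - m)) volume :=
    (hFm.comp (measurable_id.sub measurable_const)).aestronglyMeasurable
  -- the inflated form `(1+ε)Q` is dominated, of rank ≤ r, and integrable against the Gaussian
  have hQ' : ((1 + ε) • Q).PosSemidef := hQ.smul (by linarith)
  have hr' : ((1 + ε) • Q).rank ≤ r := by
    have hu : IsUnit ((1 + ε) • (1 : Matrix n n ℝ)).det := by
      rw [det_smul, det_one, mul_one]; exact isUnit_iff_ne_zero.2 (pow_ne_zero _ (by linarith))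
    have e : (1 + ε) • Q = ((1 + ε) • (1 : Matrix n n ℝ)) * Q := by rw [Matrix.smul_mul, Matrix.one_mul]
    rw [e, Matrix.rank_mul_eq_right_of_isUnit_det _ _ hu]; exact hr
  have hI : Integrable (fun u : n → ℝ => exp (u ⬝ᵥ (((1 + ε) • Q) *ᵥ u)) * exp (-(u ⬝ᵥ (S *ᵥ u)))) :=
    integrable_exp_qf_mul_exp_neg_qf hS hQ' hdom hδ
  -- pointwise Young: `F(u−m)·e^{Q(u−m)} ≤ e^{(1+ε⁻¹)mᵀQm} · e^{(1+ε)uᵀQu}`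
  have hpt : ∀ u, (F (u - m) * exp ((u - m) ⬝ᵥ (Q *ᵥ (u - m)))) * exp (-(u ⬝ᵥ (S *ᵥ u))) ≤
      exp ((1 + ε⁻¹) * (m ⬝ᵥ (Q *ᵥ m))) * (exp (u ⬝ᵥ (((1 + ε) • Q) *ᵥ u)) * exp (-(u ⬝ᵥ (S *ᵥ u)))) := by
    intro u
    have hy := qf_young hQ u m hε
    have h1 : exp ((u - m) ⬝ᵥ (Q *ᵥ (u - m))) ≤ exp ((1 + ε⁻¹) * (m ⬝ᵥ (Q *ᵥ m))) * exp (u ⬝ᵥ (((1 + ε) • Q) *ᵥ u)) := by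
      rw [← exp_add, qf_smul]
      exact exp_le_exp.2 (by linarith)
    have h2 : F (u - m) * exp ((u - m) ⬝ᵥ (Q *ᵥ (u - m))) ≤
        exp ((1 + ε⁻¹) * (m ⬝ᵥ (Q *ᵥ m))) * exp (u ⬝ᵥ (((1 + ε) • Q) *ᵥ u)) :=
      calc F (u - m) * exp ((u - m) ⬝ᵥ (Q *ᵥ (u - m))) ≤ 1 * exp ((u - m) ⬝ᵥ (Q *ᵥ (u - m))) :=
            mul_le_mul_of_nonneg_right (hG1 u) (exp_pos _).le
        _ ≤ _ := by rw [one_mul]; exact h1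
    have h3 := mul_le_mul_of_nonneg_right h2 (exp_pos (-(u ⬝ᵥ (S *ᵥ u)))).le
    simpa only [mul_assoc] using h3
  have hnum : ∫ u, (F (u - m) * exp ((u - m) ⬝ᵥ (Q *ᵥ (u - m)))) * exp (-(u ⬝ᵥ (S *ᵥ u))) ≤
      exp ((1 + ε⁻¹) * (m ⬝ᵥ (Q *ᵥ m))) * ((√(1 - δ'))⁻¹ ^ r * ∫ u, exp (-(u ⬝ᵥ (S *ᵥ u)))) := by
    calc ∫ u, (F (u - m) * exp ((u - m) ⬝ᵥ (Q *ᵥ (u - m)))) * exp (-(u ⬝ᵥ (S *ᵥ u)))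
        ≤ ∫ u, exp ((1 + ε⁻¹) * (m ⬝ᵥ (Q *ᵥ m))) * (exp (u ⬝ᵥ (((1 + ε) • Q) *ᵥ u)) * exp (-(u ⬝ᵥ (S *ᵥ u)))) :=
          integral_mono_of_nonneg (Filter.Eventually.of_forall fun u =>
            mul_nonneg (mul_nonneg (hG0 u) (exp_pos _).le) (exp_pos _).le) (hI.const_mul _)
            (Filter.Eventually.of_forall hpt)
      _ = exp ((1 + ε⁻¹) * (m ⬝ᵥ (Q *ᵥ m))) * ∫ u, exp (u ⬝ᵥ (((1 + ε) • Q) *ᵥ u)) * exp (-(u ⬝ᵥ (S *ᵥ u))) :=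
          integral_const_mul _ _
      _ ≤ _ := mul_le_mul_of_nonneg_left (integral_exp_qf_le_of_dominated hS hQ' hdom hδ0 hδ hr') (exp_pos _).le
  -- the denominator: `(1 − η)·∫e^{−S} ≤ ∫ F(u−m) e^{−S}`
  have hI0 := integral_exp_neg_qf_pos hS
  have hsplit : ∫ u, (1 - F (u - m)) * exp (-(u ⬝ᵥ (S *ᵥ u))) =
      (∫ u, exp (-(u ⬝ᵥ (S *ᵥ u)))) - ∫ u, F (u - m) * exp (-(u ⬝ᵥ (S *ᵥ u))) := by
    have e : ∀ u : n → ℝ, (1 - F (u - m)) * exp (-(u ⬝ᵥ (S *ᵥ u))) =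
        exp (-(u ⬝ᵥ (S *ᵥ u))) - F (u - m) * exp (-(u ⬝ᵥ (S *ᵥ u))) := fun u => by ring
    simp_rw [e]
    exact integral_sub (integrable_exp_neg_qf hS) (integrable_bdd_mul_exp_neg_qf hS hG0 hG1 hGm)
  have hden : (1 - η) * ∫ u, exp (-(u ⬝ᵥ (S *ᵥ u))) ≤ ∫ u, F (u - m) * exp (-(u ⬝ᵥ (S *ᵥ u))) := by
    rw [hsplit] at hmass; linarith
  have h1η : 0 < 1 - η := by linarith
  have hK : 0 ≤ exp ((1 + ε⁻¹) * (m ⬝ᵥ (Q *ᵥ m))) * (√(1 - δ'))⁻¹ ^ r :=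
    mul_nonneg (exp_pos _).le (pow_nonneg (inv_nonneg.2 (Real.sqrt_nonneg _)) r)
  have hc : 0 < exp (m ⬝ᵥ (S *ᵥ m)) := exp_pos _
  -- assemble
  calc exp (m ⬝ᵥ (S *ᵥ m)) * ∫ u, (F (u - m) * exp ((u - m) ⬝ᵥ (Q *ᵥ (u - m)))) * exp (-(u ⬝ᵥ (S *ᵥ u)))
      ≤ exp (m ⬝ᵥ (S *ᵥ m)) * (exp ((1 + ε⁻¹) * (m ⬝ᵥ (Q *ᵥ m))) * (√(1 - δ'))⁻¹ ^ r *
          ∫ u, exp (-(u ⬝ᵥ (S *ᵥ u)))) := by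
        refine mul_le_mul_of_nonneg_left ?_ hc.le
        simpa only [mul_assoc] using hnum
    _ ≤ exp (m ⬝ᵥ (S *ᵥ m)) * (exp ((1 + ε⁻¹) * (m ⬝ᵥ (Q *ᵥ m))) * (√(1 - δ'))⁻¹ ^ r *
          ((∫ u, F (u - m) * exp (-(u ⬝ᵥ (S *ᵥ u)))) / (1 - η))) := by
        refine mul_le_mul_of_nonneg_left (mul_le_mul_of_nonneg_left ?_ hK) hc.le
        exact (le_div_iff₀ h1η).2 (by linarith)
    _ = (exp ((1 + ε⁻¹) * (m ⬝ᵥ (Q *ᵥ m))) * ((√(1 - δ'))⁻¹ ^ r / (1 - η))) *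
          (exp (m ⬝ᵥ (S *ᵥ m)) * ∫ u, F (u - m) * exp (-(u ⬝ᵥ (S *ᵥ u)))) := by ring

/-- **WITH THE INDUCED-MEAN ENERGY DISPLAYED** (residual (R1″)): if moreover `mᵀQm ≤ B₀` for the induced mean `m = S⁻¹v`, the shifted
restricted moment is at most `e^{(1+ε⁻¹)B₀}·(√(1−δ'))⁻¹ ^ r ∕ (1 − η)` times its normalisation — a constant free of `v`, hence UNIFORM
over the far configurations, as `…GaussianFibrewiseDecoupling.restrictedMoment_le_of_shifted_fibres` wants. [folklore] -/
theorem shiftedMoment_le_of_inducedMean_le {S Q : Matrix n n ℝ} {δ' ε η B₀ : ℝ} {r : ℕ} (hS : S.PosDef) (hQ : Q.PosSemidef)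
    (hε : 0 < ε) (hdom : (δ' • S - (1 + ε) • Q).PosSemidef) (hδ0 : 0 ≤ δ') (hδ : δ' < 1) (hr : Q.rank ≤ r) (v : n → ℝ)
    {F : (n → ℝ) → ℝ} (hF0 : ∀ x, 0 ≤ F x) (hF1 : ∀ x, F x ≤ 1) (hFm : Measurable F) (hη : η < 1)
    (hmass : ∫ u, (1 - F (u - S⁻¹ *ᵥ v)) * exp (-(u ⬝ᵥ (S *ᵥ u))) ≤ η * ∫ u, exp (-(u ⬝ᵥ (S *ᵥ u))))
    (hB : (S⁻¹ *ᵥ v) ⬝ᵥ (Q *ᵥ (S⁻¹ *ᵥ v)) ≤ B₀) :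
    ∫ x, F x * (exp (x ⬝ᵥ (Q *ᵥ x)) * exp (-(x ⬝ᵥ (S *ᵥ x) + 2 * (x ⬝ᵥ v)))) ≤
      (exp ((1 + ε⁻¹) * B₀) * ((√(1 - δ'))⁻¹ ^ r / (1 - η))) * ∫ x, F x * exp (-(x ⬝ᵥ (S *ᵥ x) + 2 * (x ⬝ᵥ v))) := by
  refine (shiftedMoment_le hS hQ hε hdom hδ0 hδ hr v hF0 hF1 hFm hη hmass).trans ?_
  have hD : 0 ≤ ∫ x, F x * exp (-(x ⬝ᵥ (S *ᵥ x) + 2 * (x ⬝ᵥ v))) :=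
    integral_nonneg fun x => mul_nonneg (hF0 x) (exp_pos _).le
  have h1η : 0 < 1 - η := by linarith
  refine mul_le_mul_of_nonneg_right (mul_le_mul_of_nonneg_right (exp_le_exp.2 ?_) ?_) hD
  · exact mul_le_mul_of_nonneg_left hB (by positivity)
  · exact div_nonneg (pow_nonneg (inv_nonneg.2 (Real.sqrt_nonneg _)) r) h1η.le

end Summit.QuantumFields.BalabanUV.T4Continuum.NE7b.GaussianShiftedFibre
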